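import Mathlib.Analysis.ODE.Gronwall
import Mathlib.Analysis.Normed.MulAction
import Mathlib.Analysis.Calculus.Deriv.Slope
import Mathlib.MeasureTheory.Integral.DominatedConvergence
import Mathlib.MeasureTheory.Integral.IntervalIntegral.FundThmCalculus
import Literature.NumberTheory.EllipticCurves.ComplexTorus
import Literature.NumberTheory.EllipticCurves.WeierstrassZetaLegendre
import HarnessLib

/-!
# Lifting a segment between two branch points through `℘`, and the quasi-period it computes

Auxiliary results (all proved) for the discharge of the named facts
`Literature.NumberTheory.Transcendental.isPeriod_η₁` / `isPeriod_η₂` of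
`Literature/NumberTheory/Transcendental/KontsevichZagier.lean` (Kontsevich–Zagier 2001, §1.1: the
elliptic integral of the second kind `-∮ x dx / y` on `y² = 4x³ - g₂x - g₃` is a period). This file is
the complex-analytic half of that proof: it identifies an abelian integral along the straight segment
joining two roots `p`, `q = p + d` of the Weierstrass cubic with a difference of values of the
Weierstrass zeta function at two half-lattice points.

Let `L` be a period pair with lattice `Λ`, `℘ = ℘[L]`, `ζ = L.weierstrassZeta`, and let
`γ(s) = p + s d` (`s ∈ [0, 1]`) parametrise the segment from the root `p` to the root `q = p + d` of
`f(x) = 4x³ - g₂x - g₃`. Suppose `y : ℝ → ℂ` is continuous with `y(s)² = f(γ(s))` on `[0, 1]` and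
`y ≠ 0` on `(0, 1)` (a continuous branch of the square root along the open segment; it exists when
the third root is off the segment, and is constructed in the sibling file
`KontsevichZagierEllipticIntegrandProofs.lean`), and suppose `u : ℝ → ℂ` is continuous with
`u' = d / y` on `(0, 1)` and `(℘, ℘')(u(1/2)) = (γ(1/2), y(1/2))`. Then (this file):

* `weierstrassP_segmentLift` — `(℘, ℘')(u(s)) = (γ(s), y(s))` and `u(s) ∉ Λ` for all `s ∈ (0, 1)`:
  `s ↦ (℘, ℘')(u(s))` and `s ↦ (γ(s), y(s))` solve the same first-order system
  `V' = (d / y(s)) • (V₂, 6V₁² - g₂/2)` (`℘'' = 6℘² - g₂/2`), so they agree near every point where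
  they agree (Mathlib's `ODE_solution_unique_of_eventually`), and the coincidence set is closed in
  `(0, 1)` because `℘` blows up at the lattice (`weierstrassP_comp_eq_of_mem_closure`); connectedness
  of `(0, 1)` concludes;
* `weierstrassP_segmentLift_zero/one` — at the endpoints `u(0), u(1) ∉ Λ`, `℘(u(0)) = p`,
  `℘(u(1)) = q` and `℘'(u(0)) = ℘'(u(1)) = 0`, so `2u(0), 2u(1) ∈ Λ` (the endpoints are half-lattice
  points; `PeriodPair.two_mul_mem_lattice_of_derivWeierstrassP_eq_zero`);
* `weierstrassZeta_segmentLift_one_sub_zero` — **the abelian integral of the second kind**: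
  `ζ(u(1)) - ζ(u(0)) = -∫₀¹ γ(s) d / y(s) ds` (`ζ' = -℘`, fundamental theorem of calculus on
  compact subintervals of `(0, 1)` and continuity up to the endpoints);
* `two_mul_weierstrassZeta_half_lattice` — for `λ = mω₁ + nω₂ ∈ Λ`, `2ζ(λ/2) = mη₁ + nη₂`
  (quasi-periodicity `ζ(z + ωᵢ) = ζ(z) + ηᵢ`, Whittaker–Watson §20.41, and oddness of `ζ`), which
  turns the previous identity into `η(2u(1) - 2u(0)) = -2∫₀¹ γ d / y`.

No new definitions are introduced (hypotheses are carried explicitly); the namespace is the path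
namespace `Literature.NumberTheory.Transcendental`.

## References

* M. Kontsevich, D. Zagier, *Periods* (2001), §1.1 (elliptic integrals among the periods).
* E. T. Whittaker, G. N. Watson, *A Course of Modern Analysis*, §20.22 (`℘'' = 6℘² - g₂/2`),
  §20.41 (quasi-periodicity of `ζ`), §20.32 (zeros of `℘'` are the half-periods).
* J. H. Silverman, *The Arithmetic of Elliptic Curves*, VI.3 (the map `z ↦ (℘(z), ℘'(z))`).
-/

noncomputable section

open Filter Metric Set MeasureTheory intervalIntegral Bornology Complex
open scoped Topology NNReal PeriodPair

namespace Literature.NumberTheory.Transcendental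

variable (L : PeriodPair)

/-! ### Quasi-periodicity of `ζ` along the whole lattice -/

/-- `ζ(z + mω₁) = ζ(z) + mη₁` for every integer `m` and every `z` (iteration of
`ζ(z + ω₁) = ζ(z) + η₁`, Whittaker–Watson §20.41). [cite: WhittakerWatson1927, §20.41] -/
theorem weierstrassZeta_add_int_mul_ω₁ (z : ℂ) (m : ℤ) :
    L.weierstrassZeta (z + m * L.ω₁) = L.weierstrassZeta z + m * L.η₁ := by
  induction m using Int.induction_on with
  | zero => simp
  | succ n ih =>
    have h := L.weierstrassZeta_add_ω₁_eq (z + (n : ℂ) * L.ω₁)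
    have ih' : L.weierstrassZeta (z + (n : ℂ) * L.ω₁) = L.weierstrassZeta z + (n : ℂ) * L.η₁ := by
      exact_mod_cast ih
    push_cast
    rw [show z + ((n : ℂ) + 1) * L.ω₁ = z + (n : ℂ) * L.ω₁ + L.ω₁ by ring, h, ih']
    ring
  | pred n ih =>
    have h := L.weierstrassZeta_add_ω₁_eq (z + (-(n : ℂ) - 1) * L.ω₁)
    have ih' : L.weierstrassZeta (z + (-(n : ℂ)) * L.ω₁) =
        L.weierstrassZeta z + (-(n : ℂ)) * L.η₁ := by
      exact_mod_cast ih
    push_cast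
    rw [show z + (-(n : ℂ) - 1) * L.ω₁ + L.ω₁ = z + (-(n : ℂ)) * L.ω₁ by ring, ih'] at h
    linear_combination -h

/-- `ζ(z + nω₂) = ζ(z) + nη₂` for every integer `n` and every `z` (iteration of
`ζ(z + ω₂) = ζ(z) + η₂`, Whittaker–Watson §20.41). [cite: WhittakerWatson1927, §20.41] -/
theorem weierstrassZeta_add_int_mul_ω₂ (z : ℂ) (n : ℤ) :
    L.weierstrassZeta (z + n * L.ω₂) = L.weierstrassZeta z + n * L.η₂ := by
  induction n using Int.induction_on with
  | zero => simp
  | succ n ih =>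
    have h := L.weierstrassZeta_add_ω₂_eq (z + (n : ℂ) * L.ω₂)
    have ih' : L.weierstrassZeta (z + (n : ℂ) * L.ω₂) = L.weierstrassZeta z + (n : ℂ) * L.η₂ := by
      exact_mod_cast ih
    push_cast
    rw [show z + ((n : ℂ) + 1) * L.ω₂ = z + (n : ℂ) * L.ω₂ + L.ω₂ by ring, h, ih']
    ring
  | pred n ih =>
    have h := L.weierstrassZeta_add_ω₂_eq (z + (-(n : ℂ) - 1) * L.ω₂)
    have ih' : L.weierstrassZeta (z + (-(n : ℂ)) * L.ω₂) =
        L.weierstrassZeta z + (-(n : ℂ)) * L.η₂ := by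
      exact_mod_cast ih
    push_cast
    rw [show z + (-(n : ℂ) - 1) * L.ω₂ + L.ω₂ = z + (-(n : ℂ)) * L.ω₂ by ring, ih'] at h
    linear_combination -h

/-- Quasi-periodicity of `ζ` along the lattice vector `mω₁ + nω₂`:
`ζ(z + mω₁ + nω₂) = ζ(z) + mη₁ + nη₂` for every `z` (Whittaker–Watson §20.41).
[cite: WhittakerWatson1927, §20.41] -/
theorem weierstrassZeta_add_int_mul_add_int_mul (z : ℂ) (m n : ℤ) :
    L.weierstrassZeta (z + (m * L.ω₁ + n * L.ω₂)) =
      L.weierstrassZeta z + (m * L.η₁ + n * L.η₂) := by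
  rw [show z + (m * L.ω₁ + n * L.ω₂) = (z + m * L.ω₁) + n * L.ω₂ by ring,
    weierstrassZeta_add_int_mul_ω₂ L, weierstrassZeta_add_int_mul_ω₁ L]
  ring

/-- **Value of `ζ` at a half-lattice point.** For `λ = mω₁ + nω₂ ∈ Λ`,
`2ζ(λ/2) = mη₁ + nη₂`: by oddness `ζ(λ/2) = -ζ(-λ/2)` and by quasi-periodicity
`ζ(-λ/2 + λ) = ζ(-λ/2) + mη₁ + nη₂` (Whittaker–Watson §20.41; this generalises `η₁ = 2ζ(ω₁/2)`).
[cite: WhittakerWatson1927, §20.41] -/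
theorem two_mul_weierstrassZeta_half_lattice (m n : ℤ) :
    2 * L.weierstrassZeta ((m * L.ω₁ + n * L.ω₂) / 2) = m * L.η₁ + n * L.η₂ := by
  have h := weierstrassZeta_add_int_mul_add_int_mul L (-((m * L.ω₁ + n * L.ω₂) / 2)) m n
  rw [L.weierstrassZeta_neg, show -((m * L.ω₁ + n * L.ω₂) / 2) + (m * L.ω₁ + n * L.ω₂) =
    (m * L.ω₁ + n * L.ω₂) / 2 by ring] at h
  linear_combination h

/-- `℘'` vanishes at every point `h` with `2h ∈ Λ` (at lattice points this is Mathlib's junk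
value `℘'(l) = 0`; at proper half-lattice points it is the classical fact that the half-periods are
critical points of `℘`, from oddness and periodicity of `℘'`; Whittaker–Watson §20.32). [folklore] -/
theorem derivWeierstrassP_eq_zero_of_two_mul_mem {h : ℂ} (hh : 2 * h ∈ L.lattice) :
    ℘'[L] h = 0 := by
  have e := L.derivWeierstrassP_add_coe (-h) ⟨2 * h, hh⟩
  rw [show -h + ((⟨2 * h, hh⟩ : L.lattice) : ℂ) = h by push_cast; ring,
    L.derivWeierstrassP_neg] at e
  linear_combination e / 2

/-! ### A closure lemma: `℘ ∘ u = γ` persists to limit points -/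

variable {L}

/-- **Closure lemma.** Let `u, γ, y : ℝ → ℂ` be continuous and suppose that on a set `S` the path
`u` avoids the lattice and `℘(u(t)) = γ(t)`, `℘'(u(t)) = y(t)`. Then the same three statements hold
at every point of the closure of `S`: if `u(s)` were a lattice point then `℘(u(t)) = γ(t)` would be
unbounded as `t → s` inside `S` (`℘` has a pole at every lattice point), contradicting the
continuity of `γ`; and off the lattice `℘, ℘'` are continuous. [folklore] -/
theorem weierstrassP_comp_eq_of_mem_closure {S : Set ℝ} {u γ y : ℝ → ℂ} (hu : Continuous u)
    (hγ : Continuous γ) (hy : Continuous y)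
    (h : ∀ t ∈ S, u t ∉ L.lattice ∧ ℘[L] (u t) = γ t ∧ ℘'[L] (u t) = y t) {s : ℝ}
    (hs : s ∈ closure S) :
    u s ∉ L.lattice ∧ ℘[L] (u s) = γ s ∧ ℘'[L] (u s) = y s := by
  haveI hne : (𝓝[S] s).NeBot := mem_closure_iff_nhdsWithin_neBot.mp hs
  have hγt : Tendsto (fun t => ℘[L] (u t)) (𝓝[S] s) (𝓝 (γ s)) := by
    refine ((hγ.tendsto s).mono_left nhdsWithin_le_nhds).congr' ?_
    filter_upwards [self_mem_nhdsWithin] with t ht using (h t ht).2.1.symm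
  have hyt : Tendsto (fun t => ℘'[L] (u t)) (𝓝[S] s) (𝓝 (y s)) := by
    refine ((hy.tendsto s).mono_left nhdsWithin_le_nhds).congr' ?_
    filter_upwards [self_mem_nhdsWithin] with t ht using (h t ht).2.2.symm
  -- `u s` is not a lattice point
  have hnot : u s ∉ L.lattice := by
    intro hl
    have h1 : Tendsto u (𝓝[S] s) (𝓝[≠] (u s)) := by
      refine tendsto_nhdsWithin_of_tendsto_nhds_of_eventually_within _
        ((hu.tendsto s).mono_left nhdsWithin_le_nhds) ?_
      filter_upwards [self_mem_nhdsWithin] with t ht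
      exact fun heq => (h t ht).1 (by rw [mem_singleton_iff.mp heq]; exact hl)
    have h2 : Tendsto (fun t => ℘[L] (u t)) (𝓝[S] s) (cobounded ℂ) :=
      (PeriodPair.tendsto_weierstrassP_cobounded hl).comp h1
    exact hγt.not_tendsto (Metric.disjoint_nhds_cobounded _) h2
  have hopen : IsOpen ((L.lattice : Set ℂ)ᶜ) := L.isClosed_lattice.isOpen_compl
  have hPc : ContinuousAt ℘[L] (u s) :=
    (L.differentiableOn_weierstrassP.differentiableAt (hopen.mem_nhds hnot)).continuousAt
  have hP'c : ContinuousAt ℘'[L] (u s) :=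
    (L.differentiableOn_derivWeierstrassP.differentiableAt (hopen.mem_nhds hnot)).continuousAt
  have t1 : Tendsto (fun t => ℘[L] (u t)) (𝓝[S] s) (𝓝 (℘[L] (u s))) :=
    (hPc.tendsto.comp (hu.tendsto s)).mono_left nhdsWithin_le_nhds
  have t2 : Tendsto (fun t => ℘'[L] (u t)) (𝓝[S] s) (𝓝 (℘'[L] (u s))) :=
    (hP'c.tendsto.comp (hu.tendsto s)).mono_left nhdsWithin_le_nhds
  exact ⟨hnot, tendsto_nhds_unique t1 hγt, tendsto_nhds_unique t2 hyt⟩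

/-! ### Derivative of a continuous branch of a square root -/

/-- If `y` is continuous at `s`, `y(s) ≠ 0`, and `y² = Q` near `s` with `Q` differentiable at `s`,
then `y` is differentiable at `s` with `y'(s) = Q'(s) / (2 y(s))`:
`(y(t) - y(s)) / (t - s) = ((Q(t) - Q(s)) / (t - s)) · (y(t) + y(s))⁻¹`. [folklore] -/
theorem hasDerivAt_of_sq_eq {y Q : ℝ → ℂ} {Q' : ℂ} {s : ℝ} (hyc : ContinuousAt y s)
    (hQ : HasDerivAt Q Q' s) (hsq : ∀ᶠ t in 𝓝 s, y t ^ 2 = Q t) (hy0 : y s ≠ 0) :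
    HasDerivAt y (Q' / (2 * y s)) s := by
  rw [hasDerivAt_iff_tendsto_slope] at hQ ⊢
  have h2 : (2 : ℂ) * y s ≠ 0 := mul_ne_zero two_ne_zero hy0
  -- `y t + y s → 2 y s ≠ 0`
  have hsum : Tendsto (fun t => y t + y s) (𝓝[≠] s) (𝓝 (2 * y s)) := by
    have := ((hyc.tendsto).add_const (y s)).mono_left (nhdsWithin_le_nhds (s := {s}ᶜ))
    simpa [two_mul] using this
  have hne : ∀ᶠ t in 𝓝[≠] s, y t + y s ≠ 0 :=
    hsum.eventually_ne h2
  have hsq' : ∀ᶠ t in 𝓝[≠] s, y t ^ 2 = Q t := mem_nhdsWithin_of_mem_nhds hsq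
  have hsqs : y s ^ 2 = Q s := hsq.self_of_nhds
  have key : ∀ᶠ t in 𝓝[≠] s, slope Q s t * (y t + y s)⁻¹ = slope y s t := by
    filter_upwards [hne, hsq'] with t ht hQt
    simp only [slope, vsub_eq_sub]
    rw [← hQt, ← hsqs, show y t ^ 2 - y s ^ 2 = (y t - y s) * (y t + y s) by ring,
      smul_mul_assoc, mul_assoc, mul_inv_cancel₀ ht, mul_one]
  have := (hQ.mul (hsum.inv₀ h2)).congr' key
  simpa [div_eq_mul_inv] using this

/-! ### The lift of the segment `[p, q]` through `℘` -/

section Lift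

variable {p d w₀ : ℂ} {y u : ℝ → ℂ}

/-- The parametrised Weierstrass cubic along the segment, `Q(t) = f(p + t d)`, has derivative
`d · (12 (p + s d)² - g₂)` in the real parameter. [folklore] -/
theorem hasDerivAt_cubic_segment (L : PeriodPair) (p d : ℂ) (s : ℝ) :
    HasDerivAt (fun t : ℝ => 4 * (p + t * d) ^ 3 - L.g₂ * (p + t * d) - L.g₃)
      (d * (12 * (p + s * d) ^ 2 - L.g₂)) s := by
  have hE : HasDerivAt (fun w : ℂ => 4 * (p + w * d) ^ 3 - L.g₂ * (p + w * d) - L.g₃)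
      (d * (12 * (p + s * d) ^ 2 - L.g₂)) (s : ℂ) := by
    have hγ : HasDerivAt (fun w : ℂ => p + w * d) d (s : ℂ) := by
      simpa using ((hasDerivAt_id (s : ℂ)).mul_const d).const_add p
    have h := (((hγ.fun_pow 3).const_mul 4).fun_sub (hγ.const_mul L.g₂)).sub_const L.g₃
    refine h.congr_deriv ?_
    simp only [Nat.reduceSub, Nat.cast_ofNat]
    ring
  exact hE.comp_ofReal

/-- Along the open segment, a continuous branch `y` of `√f(p + s d)` is differentiable with
`y' = d (6 (p + s d)² - g₂/2) / y` (from `y² = f(γ)`: `2 y y' = f'(γ) γ'`). [folklore] -/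
theorem hasDerivAt_sqrt_cubic_segment (L : PeriodPair) (hyc : Continuous y)
    (hsq : ∀ s ∈ Icc (0 : ℝ) 1, y s ^ 2 = 4 * (p + s * d) ^ 3 - L.g₂ * (p + s * d) - L.g₃)
    (hy0 : ∀ s ∈ Ioo (0 : ℝ) 1, y s ≠ 0) {s : ℝ} (hs : s ∈ Ioo (0 : ℝ) 1) :
    HasDerivAt y (d * (6 * (p + s * d) ^ 2 - L.g₂ / 2) / y s) s := by
  have hev : ∀ᶠ t in 𝓝 s, y t ^ 2 = 4 * (p + t * d) ^ 3 - L.g₂ * (p + t * d) - L.g₃ := by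
    filter_upwards [Ioo_mem_nhds hs.1 hs.2] with t ht using hsq t (Ioo_subset_Icc_self ht)
  have h := hasDerivAt_of_sq_eq hyc.continuousAt (hasDerivAt_cubic_segment L p d s) hev (hy0 s hs)
  convert h using 1
  field_simp [hy0 s hs]
  ring

/-- **Local step of the lift** (uniqueness for the first-order system satisfied by `(℘, ℘')`).
If `u` is continuous with `u' = d / y` on `(0, 1)` and at some `s₁ ∈ (0, 1)` we have `u(s₁) ∉ Λ`,
`℘(u(s₁)) = p + s₁ d`, `℘'(u(s₁)) = y(s₁)`, then the same holds for all `s` near `s₁`: both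
`s ↦ (℘(u(s)), ℘'(u(s)))` and `s ↦ (p + s d, y(s))` solve `V' = (d / y(s)) • (V₂, 6V₁² - g₂/2)`
(`℘'' = 6℘² - g₂/2`, Whittaker–Watson §20.22) with the same value at `s₁`, and the field is locally
Lipschitz (Mathlib `ODE_solution_unique_of_eventually`). [folklore] -/
theorem eventually_weierstrassP_segmentLift (L : PeriodPair) (hyc : Continuous y)
    (hsq : ∀ s ∈ Icc (0 : ℝ) 1, y s ^ 2 = 4 * (p + s * d) ^ 3 - L.g₂ * (p + s * d) - L.g₃)
    (hy0 : ∀ s ∈ Ioo (0 : ℝ) 1, y s ≠ 0) (huc : Continuous u)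
    (hu' : ∀ s ∈ Ioo (0 : ℝ) 1, HasDerivAt u (d / y s) s) {s₁ : ℝ} (hs₁ : s₁ ∈ Ioo (0 : ℝ) 1)
    (h₁ : u s₁ ∉ L.lattice ∧ ℘[L] (u s₁) = p + s₁ * d ∧ ℘'[L] (u s₁) = y s₁) :
    ∀ᶠ s in 𝓝 s₁, u s ∉ L.lattice ∧ ℘[L] (u s) = p + s * d ∧ ℘'[L] (u s) = y s := by
  have hopen : IsOpen ((L.lattice : Set ℂ)ᶜ) := L.isClosed_lattice.isOpen_compl
  -- the two solutions and the time-dependent field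
  set Φ : ℝ → ℂ × ℂ := fun s => (℘[L] (u s), ℘'[L] (u s)) with hΦ
  set Ψ : ℝ → ℂ × ℂ := fun s => (p + s * d, y s) with hΨ
  set v : ℝ → ℂ × ℂ → ℂ × ℂ := fun s V => (d / y s) • L.weierstrassField V with hv
  have hΦΨ : Φ s₁ = Ψ s₁ := by simp [hΦ, hΨ, h₁.2.1, h₁.2.2]
  -- eventually: inside `(0, 1)` and off the lattice
  have hI : ∀ᶠ s in 𝓝 s₁, s ∈ Ioo (0 : ℝ) 1 := Ioo_mem_nhds hs₁.1 hs₁.2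
  have hΛ : ∀ᶠ s in 𝓝 s₁, u s ∉ L.lattice :=
    huc.continuousAt.preimage_mem_nhds (hopen.mem_nhds h₁.1)
  -- a neighbourhood of `Ψ s₁` on which the field is Lipschitz
  obtain ⟨K, T, hT, hK⟩ :=
    (L.contDiff_weierstrassField.contDiffAt (x := Ψ s₁)).exists_lipschitzOnWith
  -- a uniform bound for the scalar factor `d / y s` near `s₁`
  have hys₁ : y s₁ ≠ 0 := hy0 s₁ hs₁
  have hcq : ContinuousAt (fun s => d / y s) s₁ := continuousAt_const.div hyc.continuousAt hys₁
  set M : ℝ := ‖d / y s₁‖ + 1 with hM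
  have hMev : ∀ᶠ s in 𝓝 s₁, ‖d / y s‖ ≤ M := by
    have : ∀ᶠ s in 𝓝 s₁, dist (d / y s) (d / y s₁) < 1 :=
      (Metric.tendsto_nhds.mp hcq.tendsto) 1 one_pos
    filter_upwards [this] with s hs
    have := norm_sub_norm_le (d / y s) (d / y s₁)
    rw [dist_eq_norm] at hs
    linarith
  have hLip : ∀ᶠ s in 𝓝 s₁, LipschitzOnWith (M.toNNReal * K) (v s) T := by
    filter_upwards [hMev] with s hs
    have h1 : LipschitzOnWith (‖d / y s‖₊ * K) (v s) T :=
      (lipschitzWith_smul (d / y s)).comp_lipschitzOnWith hK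
    refine h1.weaken ?_
    gcongr
    rw [← NNReal.coe_le_coe, coe_nnnorm, Real.coe_toNNReal _ (by positivity)]
    exact hs
  -- `Φ` solves the system near `s₁`
  have hΦd : ∀ᶠ s in 𝓝 s₁, HasDerivAt Φ (v s (Φ s)) s ∧ Φ s ∈ T := by
    have hΦc : ContinuousAt Φ s₁ := by
      have h1 : ContinuousAt ℘[L] (u s₁) :=
        (L.differentiableOn_weierstrassP.differentiableAt (hopen.mem_nhds h₁.1)).continuousAt
      have h2 : ContinuousAt ℘'[L] (u s₁) :=
        (L.differentiableOn_derivWeierstrassP.differentiableAt (hopen.mem_nhds h₁.1)).continuousAt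
      exact (h1.comp huc.continuousAt).prodMk (h2.comp huc.continuousAt)
    have hΦT : ∀ᶠ s in 𝓝 s₁, Φ s ∈ T := hΦc.preimage_mem_nhds (by rwa [hΦΨ])
    filter_upwards [hI, hΛ, hΦT] with s hs hsΛ hsT
    refine ⟨?_, hsT⟩
    have hd1 : HasDerivAt (fun t => ℘[L] (u t)) (℘'[L] (u s) * (d / y s)) s :=
      (PeriodPair.hasDerivAt_weierstrassP hsΛ).comp s (hu' s hs)
    have hd2 : HasDerivAt (fun t => ℘'[L] (u t)) ((6 * ℘[L] (u s) ^ 2 - L.g₂ / 2) * (d / y s)) s :=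
      (L.hasDerivAt_derivWeierstrassP hsΛ).comp s (hu' s hs)
    have := hd1.prodMk hd2
    convert this using 1
    simp only [hv, hΦ, PeriodPair.weierstrassField, Prod.smul_mk, smul_eq_mul]
    ext <;> ring
  -- `Ψ` solves the system near `s₁`
  have hΨd : ∀ᶠ s in 𝓝 s₁, HasDerivAt Ψ (v s (Ψ s)) s ∧ Ψ s ∈ T := by
    have hΨc : Continuous Ψ := by
      have : Continuous fun s : ℝ => p + (s : ℂ) * d := by fun_prop
      exact this.prodMk hyc
    have hΨT : ∀ᶠ s in 𝓝 s₁, Ψ s ∈ T := hΨc.continuousAt.preimage_mem_nhds hT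
    filter_upwards [hI, hΨT] with s hs hsT
    refine ⟨?_, hsT⟩
    have hd1 : HasDerivAt (fun t : ℝ => p + t * d) d s := by
      have h1 : HasDerivAt (fun t : ℝ => (t : ℂ)) 1 s := by
        simpa using (hasDerivAt_id s).ofReal_comp
      simpa using (h1.mul_const d).const_add p
    have hd2 := hasDerivAt_sqrt_cubic_segment L hyc hsq hy0 hs
    have := hd1.prodMk hd2
    convert this using 1
    simp only [hv, hΨ, PeriodPair.weierstrassField, Prod.smul_mk, smul_eq_mul]
    ext
    · simp only
      field_simp [hy0 s hs]
    · simp only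
      ring
  have hloc : Φ =ᶠ[𝓝 s₁] Ψ :=
    ODE_solution_unique_of_eventually (v := v) (s := fun _ => T) hLip hΦd hΨd hΦΨ
  filter_upwards [hloc, hΛ] with s hs hsΛ
  have h1 := congrArg Prod.fst hs
  have h2 := congrArg Prod.snd hs
  simp only [hΦ, hΨ] at h1 h2
  exact ⟨hsΛ, h1, h2⟩

/-- **The lift of the segment.** Let `y` be a continuous branch of `√f(p + s d)` on `[0, 1]`,
non-vanishing on `(0, 1)`, and let `u` be continuous with `u' = d / y` on `(0, 1)` and
`u(1/2) = w₀ ∉ Λ`, `℘(w₀) = p + d/2`, `℘'(w₀) = y(1/2)`. Then for every `s ∈ (0, 1)`: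
`u(s) ∉ Λ`, `℘(u(s)) = p + s d` and `℘'(u(s)) = y(s)` — i.e. `s ↦ (℘(u(s)), ℘'(u(s)))` is the lift
to the curve `Y² = 4X³ - g₂X - g₃` of the segment from `p` towards `p + d`, through Silverman's map
`z ↦ (℘(z), ℘'(z))` (AEC VI.3.6). Proof: the set of such `s` is open (local uniqueness,
`eventually_weierstrassP_segmentLift`), closed in `(0, 1)` (`weierstrassP_comp_eq_of_mem_closure`)
and contains `1/2`, and `(0, 1)` is connected. [folklore] -/
theorem weierstrassP_segmentLift (L : PeriodPair) (hyc : Continuous y)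
    (hsq : ∀ s ∈ Icc (0 : ℝ) 1, y s ^ 2 = 4 * (p + s * d) ^ 3 - L.g₂ * (p + s * d) - L.g₃)
    (hy0 : ∀ s ∈ Ioo (0 : ℝ) 1, y s ≠ 0) (huc : Continuous u)
    (hu' : ∀ s ∈ Ioo (0 : ℝ) 1, HasDerivAt u (d / y s) s) (hu0 : u (1 / 2) = w₀)
    (hw₀ : w₀ ∉ L.lattice) (hw₀P : ℘[L] w₀ = p + (1 / 2 : ℝ) * d) (hw₀P' : ℘'[L] w₀ = y (1 / 2))
    {s : ℝ} (hs : s ∈ Ioo (0 : ℝ) 1) :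
    u s ∉ L.lattice ∧ ℘[L] (u s) = p + s * d ∧ ℘'[L] (u s) = y s := by
  set S₀ : Set ℝ := {s | s ∈ Ioo (0 : ℝ) 1 ∧
    (u s ∉ L.lattice ∧ ℘[L] (u s) = p + s * d ∧ ℘'[L] (u s) = y s)} with hS₀
  suffices hsub : Ioo (0 : ℝ) 1 ⊆ S₀ from (hsub hs).2
  have hopen : IsOpen S₀ := by
    rw [isOpen_iff_mem_nhds]
    rintro s₁ ⟨hs₁, h₁⟩
    have h := eventually_weierstrassP_segmentLift L hyc hsq hy0 huc hu' hs₁ h₁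
    have hI : ∀ᶠ s in 𝓝 s₁, s ∈ Ioo (0 : ℝ) 1 := Ioo_mem_nhds hs₁.1 hs₁.2
    exact (hI.and h).mono fun s hs => hs
  have hne : (Ioo (0 : ℝ) 1 ∩ S₀).Nonempty := by
    have h12 : (1 / 2 : ℝ) ∈ Ioo (0 : ℝ) 1 := by norm_num
    exact ⟨1 / 2, h12, h12, by rw [hu0]; exact ⟨hw₀, hw₀P, hw₀P'⟩⟩
  have hγc : Continuous fun s : ℝ => p + (s : ℂ) * d := by fun_prop
  refine isPreconnected_Ioo.subset_of_closure_inter_subset hopen hne ?_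
  rintro s ⟨hsc, hsI⟩
  refine ⟨hsI, ?_⟩
  have hS' : S₀ ⊆ {t | u t ∉ L.lattice ∧ ℘[L] (u t) = p + t * d ∧ ℘'[L] (u t) = y t} :=
    fun t ht => ht.2
  exact weierstrassP_comp_eq_of_mem_closure huc hγc hyc (fun t ht => hS' ht)
    (closure_mono (subset_refl _) hsc)

/-- **Endpoints of the lift.** Under the hypotheses of `weierstrassP_segmentLift`, at `s = 0`:
`u(0) ∉ Λ`, `℘(u(0)) = p` and `℘'(u(0)) = y(0)` (continuity up to the endpoint, by the closure
lemma applied to `S = (0, 1)`). [folklore] -/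
theorem weierstrassP_segmentLift_zero (L : PeriodPair) (hyc : Continuous y)
    (hsq : ∀ s ∈ Icc (0 : ℝ) 1, y s ^ 2 = 4 * (p + s * d) ^ 3 - L.g₂ * (p + s * d) - L.g₃)
    (hy0 : ∀ s ∈ Ioo (0 : ℝ) 1, y s ≠ 0) (huc : Continuous u)
    (hu' : ∀ s ∈ Ioo (0 : ℝ) 1, HasDerivAt u (d / y s) s) (hu0 : u (1 / 2) = w₀)
    (hw₀ : w₀ ∉ L.lattice) (hw₀P : ℘[L] w₀ = p + (1 / 2 : ℝ) * d) (hw₀P' : ℘'[L] w₀ = y (1 / 2)) :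
    u 0 ∉ L.lattice ∧ ℘[L] (u 0) = p ∧ ℘'[L] (u 0) = y 0 := by
  have hγc : Continuous fun s : ℝ => p + (s : ℂ) * d := by fun_prop
  have h := weierstrassP_comp_eq_of_mem_closure (S := Ioo (0 : ℝ) 1) huc hγc hyc
    (fun t ht => weierstrassP_segmentLift L hyc hsq hy0 huc hu' hu0 hw₀ hw₀P hw₀P' ht)
    (s := 0) (by rw [closure_Ioo zero_ne_one]; exact left_mem_Icc.mpr zero_le_one)
  simpa using h

/-- **Endpoints of the lift.** Under the hypotheses of `weierstrassP_segmentLift`, at `s = 1`: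
`u(1) ∉ Λ`, `℘(u(1)) = p + d` and `℘'(u(1)) = y(1)`. [folklore] -/
theorem weierstrassP_segmentLift_one (L : PeriodPair) (hyc : Continuous y)
    (hsq : ∀ s ∈ Icc (0 : ℝ) 1, y s ^ 2 = 4 * (p + s * d) ^ 3 - L.g₂ * (p + s * d) - L.g₃)
    (hy0 : ∀ s ∈ Ioo (0 : ℝ) 1, y s ≠ 0) (huc : Continuous u)
    (hu' : ∀ s ∈ Ioo (0 : ℝ) 1, HasDerivAt u (d / y s) s) (hu0 : u (1 / 2) = w₀)
    (hw₀ : w₀ ∉ L.lattice) (hw₀P : ℘[L] w₀ = p + (1 / 2 : ℝ) * d) (hw₀P' : ℘'[L] w₀ = y (1 / 2)) :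
    u 1 ∉ L.lattice ∧ ℘[L] (u 1) = p + d ∧ ℘'[L] (u 1) = y 1 := by
  have hγc : Continuous fun s : ℝ => p + (s : ℂ) * d := by fun_prop
  have h := weierstrassP_comp_eq_of_mem_closure (S := Ioo (0 : ℝ) 1) huc hγc hyc
    (fun t ht => weierstrassP_segmentLift L hyc hsq hy0 huc hu' hu0 hw₀ hw₀P hw₀P' ht)
    (s := 1) (by rw [closure_Ioo zero_ne_one]; exact right_mem_Icc.mpr zero_le_one)
  simpa using h

/-- **The endpoints of the lift are half-lattice points.** If moreover `p` and `p + d` are roots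
of the Weierstrass cubic, then `y(0) = y(1) = 0`, so `℘'` vanishes at `u(0)` and `u(1)`, whence
`2u(0), 2u(1) ∈ Λ` (the zeros of `℘'` are the half-periods, Whittaker–Watson §20.32; tree lemma
`PeriodPair.two_mul_mem_lattice_of_derivWeierstrassP_eq_zero`). [folklore] -/
theorem two_mul_segmentLift_mem_lattice (L : PeriodPair) (hyc : Continuous y)
    (hsq : ∀ s ∈ Icc (0 : ℝ) 1, y s ^ 2 = 4 * (p + s * d) ^ 3 - L.g₂ * (p + s * d) - L.g₃)
    (hy0 : ∀ s ∈ Ioo (0 : ℝ) 1, y s ≠ 0) (huc : Continuous u)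
    (hu' : ∀ s ∈ Ioo (0 : ℝ) 1, HasDerivAt u (d / y s) s) (hu0 : u (1 / 2) = w₀)
    (hw₀ : w₀ ∉ L.lattice) (hw₀P : ℘[L] w₀ = p + (1 / 2 : ℝ) * d) (hw₀P' : ℘'[L] w₀ = y (1 / 2))
    (hp : 4 * p ^ 3 - L.g₂ * p - L.g₃ = 0) (hq : 4 * (p + d) ^ 3 - L.g₂ * (p + d) - L.g₃ = 0) :
    2 * u 0 ∈ L.lattice ∧ 2 * u 1 ∈ L.lattice := by
  have h0 := weierstrassP_segmentLift_zero L hyc hsq hy0 huc hu' hu0 hw₀ hw₀P hw₀P'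
  have h1 := weierstrassP_segmentLift_one L hyc hsq hy0 huc hu' hu0 hw₀ hw₀P hw₀P'
  have hy00 : y 0 = 0 := by
    have := hsq 0 (left_mem_Icc.mpr zero_le_one)
    simp only [ofReal_zero, zero_mul, add_zero] at this
    exact pow_eq_zero_iff two_ne_zero |>.mp (this.trans hp)
  have hy10 : y 1 = 0 := by
    have := hsq 1 (right_mem_Icc.mpr zero_le_one)
    simp only [ofReal_one, one_mul] at this
    exact pow_eq_zero_iff two_ne_zero |>.mp (this.trans hq)
  exact ⟨L.two_mul_mem_lattice_of_derivWeierstrassP_eq_zero h0.1 (h0.2.2.trans hy00),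
    L.two_mul_mem_lattice_of_derivWeierstrassP_eq_zero h1.1 (h1.2.2.trans hy10)⟩

/-- **The abelian integral of the second kind along the lifted segment.** Under the hypotheses of
`weierstrassP_segmentLift`, if the integrand `s ↦ (p + s d) d / y(s)` is integrable on `[0, 1]`,
then `ζ(u(1)) - ζ(u(0)) = -∫₀¹ (p + s d) d / y(s) ds`: on `(0, 1)` the function `ζ ∘ u` has
derivative `-℘(u(s)) u'(s) = -(p + s d) d / y(s)` (`ζ' = -℘`, Whittaker–Watson §20.4), so the
fundamental theorem of calculus gives the identity on compact subintervals, and both sides are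
continuous on `[0, 1]`. This is the integral `-∫ x dx / y` of Kontsevich–Zagier's list of periods
(2001, §1.1, "elliptic integrals"), pulled back to the `x`-segment. [folklore] -/
theorem weierstrassZeta_segmentLift_one_sub_zero (L : PeriodPair) (hyc : Continuous y)
    (hsq : ∀ s ∈ Icc (0 : ℝ) 1, y s ^ 2 = 4 * (p + s * d) ^ 3 - L.g₂ * (p + s * d) - L.g₃)
    (hy0 : ∀ s ∈ Ioo (0 : ℝ) 1, y s ≠ 0) (huc : Continuous u)
    (hu' : ∀ s ∈ Ioo (0 : ℝ) 1, HasDerivAt u (d / y s) s) (hu0 : u (1 / 2) = w₀)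
    (hw₀ : w₀ ∉ L.lattice) (hw₀P : ℘[L] w₀ = p + (1 / 2 : ℝ) * d) (hw₀P' : ℘'[L] w₀ = y (1 / 2))
    (hint : IntervalIntegrable (fun s : ℝ => (p + s * d) * d / y s) volume 0 1) :
    L.weierstrassZeta (u 1) - L.weierstrassZeta (u 0) =
      -∫ s in (0 : ℝ)..1, (p + s * d) * d / y s := by
  have hopen : IsOpen ((L.lattice : Set ℂ)ᶜ) := L.isClosed_lattice.isOpen_compl
  have hlift := fun t (ht : t ∈ Ioo (0 : ℝ) 1) =>
    weierstrassP_segmentLift L hyc hsq hy0 huc hu' hu0 hw₀ hw₀P hw₀P' ht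
  have h0 := weierstrassP_segmentLift_zero L hyc hsq hy0 huc hu' hu0 hw₀ hw₀P hw₀P'
  have h1 := weierstrassP_segmentLift_one L hyc hsq hy0 huc hu' hu0 hw₀ hw₀P hw₀P'
  -- `u t ∉ Λ` on the closed interval
  have hΛ : ∀ t ∈ Icc (0 : ℝ) 1, u t ∉ L.lattice := by
    intro t ht
    rcases eq_or_lt_of_le ht.1 with rfl | ht0
    · exact h0.1
    rcases eq_or_lt_of_le ht.2 with rfl | ht1
    · exact h1.1
    exact (hlift t ⟨ht0, ht1⟩).1
  -- derivative of `ζ ∘ u` on `(0, 1)`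
  set F : ℝ → ℂ := fun s => (p + s * d) * d / y s with hF
  have hderiv : ∀ t ∈ Ioo (0 : ℝ) 1,
      HasDerivAt (fun s => L.weierstrassZeta (u s)) (-F t) t := by
    intro t ht
    have htΛ := (hlift t ht).1
    have hζ : HasDerivAt L.weierstrassZeta (-℘[L] (u t)) (u t) := by
      have hd : DifferentiableAt ℂ L.weierstrassZeta (u t) :=
        L.differentiableOn_weierstrassZeta_holds.differentiableAt (hopen.mem_nhds htΛ)
      rw [← L.deriv_weierstrassZeta_holds (u t) htΛ]
      exact hd.hasDerivAt
    have := hζ.comp t (hu' t ht)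
    refine this.congr_deriv ?_
    rw [(hlift t ht).2.1, hF]
    ring
  -- FTC on `[a, b] ⊆ (0, 1)`, with `a = 1/2`
  have h12 : (1 / 2 : ℝ) ∈ Ioo (0 : ℝ) 1 := by norm_num
  have hint' : IntegrableOn F (Icc 0 1) :=
    (intervalIntegrable_iff_integrableOn_Icc_of_le zero_le_one).mp hint
  have hFint : ∀ a b, a ∈ Icc (0 : ℝ) 1 → b ∈ Icc (0 : ℝ) 1 → IntervalIntegrable F volume a b := by
    intro a b ha hb
    refine (hint'.mono_set ?_).intervalIntegrable
    exact uIcc_subset_Icc ha hb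
  have hftc : ∀ b ∈ Ioo (0 : ℝ) 1, L.weierstrassZeta (u b) - L.weierstrassZeta (u (1 / 2)) =
      -∫ s in (1 / 2 : ℝ)..b, F s := by
    intro b hb
    have hsub : uIcc (1 / 2 : ℝ) b ⊆ Ioo 0 1 := ordConnected_Ioo.uIcc_subset h12 hb
    have := integral_eq_sub_of_hasDerivAt (f := fun s => L.weierstrassZeta (u s))
      (f' := fun t => -F t) (fun t ht => hderiv t (hsub ht))
      ((hFint _ _ (Ioo_subset_Icc_self h12) (Ioo_subset_Icc_self hb)).neg)
    rw [intervalIntegral.integral_neg] at this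
    linear_combination -this
  -- continuity on `[0, 1]` of both sides, and passage to the endpoints
  set G : ℝ → ℂ := fun b => L.weierstrassZeta (u b) - L.weierstrassZeta (u (1 / 2)) +
    ∫ s in (1 / 2 : ℝ)..b, F s with hG
  have hGc : ContinuousOn G (Icc 0 1) := by
    have hζu : ContinuousOn (fun b => L.weierstrassZeta (u b)) (Icc 0 1) := by
      intro t ht
      have hd : DifferentiableAt ℂ L.weierstrassZeta (u t) :=
        L.differentiableOn_weierstrassZeta_holds.differentiableAt (hopen.mem_nhds (hΛ t ht))
      exact (hd.continuousAt.comp huc.continuousAt).continuousWithinAt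
    have hprim : ContinuousOn (fun b => ∫ s in (1 / 2 : ℝ)..b, F s) (Icc 0 1) := by
      have h := continuousOn_primitive_interval' (μ := volume) (f := F) (b₁ := 0) (b₂ := 1)
        (a := 1 / 2) (hFint 0 1 (left_mem_Icc.mpr zero_le_one) (right_mem_Icc.mpr zero_le_one))
        (by rw [uIcc_of_le zero_le_one]; exact Ioo_subset_Icc_self h12)
      rwa [uIcc_of_le zero_le_one] at h
    exact (hζu.sub continuousOn_const).add hprim
  have hG0 : EqOn G 0 (Icc 0 1) := by
    refine EqOn.of_subset_closure (s := Ioo 0 1) ?_ hGc continuousOn_const Ioo_subset_Icc_self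
      (by rw [closure_Ioo zero_ne_one])
    intro b hb
    simp only [hG, Pi.zero_apply, hftc b hb]
    ring
  have e0 := hG0 (left_mem_Icc.mpr zero_le_one)
  have e1 := hG0 (right_mem_Icc.mpr zero_le_one)
  simp only [hG, Pi.zero_apply] at e0 e1
  have hsplit : (∫ s in (1 / 2 : ℝ)..1, F s) - ∫ s in (1 / 2 : ℝ)..0, F s =
      ∫ s in (0 : ℝ)..1, F s :=
    integral_interval_sub_left
      (hFint _ _ (Ioo_subset_Icc_self h12) (right_mem_Icc.mpr zero_le_one))
      (hFint _ _ (Ioo_subset_Icc_self h12) (left_mem_Icc.mpr zero_le_one))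
  linear_combination e1 - e0 - hsplit

end Lift

end Literature.NumberTheory.Transcendental
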